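import Summits.HodgeConjecture.HodgeConjecture.Theorems.F0P3cStCharTSStStableEll          -- ★ p851694 «ELL-VALUE-H» (F0P3-p04): `charSt_eq_neg_xiLocalChar_of_not_mem_hyperbolicSet`
import Summits.HodgeConjecture.HodgeConjecture.Theorems.F0P3cStCharTSEllCartanCompactH     -- ★ «CARTAN-ELL-H»: `isCompact_centralizer_iff_not_mem_hyperbolicSet_H`
import Summits.HodgeConjecture.HodgeConjecture.Theorems.F0P3cStCharTSUpTrCartanFields      -- ★ p852366 (H3b) «CARTAN-FIELDS-H» (LH4-p01): `centralizer_eq_of_mem_centralizer_of_isLocalGRegular`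
import Summits.HodgeConjecture.HodgeConjecture.Theorems.F0P3cStCharTSEllMassHNull          -- ★ p852574 (B4) «ELL-MASS-H NULL» (F0P3a-p04): `ae_isLocalGRegular_of_eq_centralizerH`
import Literature.NumberTheory.Rogawski1990.XiLocalCharacter                               -- ★ `norm_xiLocalChar_apply_eq_one`
import Literature.NumberTheory.Rogawski1990.Ch12Sec5Inputs                                 -- ★ the organ's vocabulary: `EllipticData.PacketCharHNorm`, `PacketCharHRegularity`, `innerH`, `packetCharH`
import HarnessLib

/-!
# F0 · P3c · line LH6 «StCharTS» — road «M5-H» (charter T14-41, census `F0/P3a/F0P3a-p04/g29/m5h/CENSUS-M5H.v1`), bricks (M5-a) «ELL-NORM-H» + (B6) «M5 JUNCTION»: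
# `|χ_{St_H(ξ)}|² = 1` almost everywhere on every compact Cartan representative of `H_v = U(Φ₂)(L⁺_v) × U(Φ₁)(L⁺_v)`, and the block consequent (M5)
# `⟨χ_ρ, χ_ρ⟩_{H,e} = Card ρ` AT THE PINS of RUNG 0 from the elliptic Weyl mass `Σ_{T ∈ SH} |Ω(T,H)|⁻¹ ∫_T D_H² = 1`

Cell `pub/hodgecm-mathlib`, crux H413 = `stmt-HodgeConjecture-24833` (lane `--supports … --as helper`), route HCCMUnconditional; seat F0P3b-p01 (g21).  THEOREMS ONLY
(no definition ∕ instance ∕ notation ∕ named fact ∕ `sorry`); ★-only imports.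

WHY.  The block consequent (M5) `Ch12Sec5.EllipticData.PacketCharHNorm` of ★ RUNG 0 v8 (`F0P3cStCharTSRung0Eight` :212; booked PRINT «`⟨χ_ρ, χ_ρ⟩_{H,e} = Card ρ` … follows
from the local Jacquet–Langlands correspondence» [Rogawski1990, Cor. 12.5.4 proof p. 186]) reads, at the pins `eSq : 𝔇.sqPacketsH = {{πSt}}`, `eCartanH`, `eMuTH`, `eDH`:
`Σ_{T ∈ SH} |Ω(T,H)|⁻¹ ∫_T D_H(t)² · Θ(t) · conj Θ(t) dμTHf(T) = 1` with `Θ = χ_{St_H(ξ_v)}` (`Ch12Sec5Defs.innerH`, `packetCharH`).  This file proves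
* §1 (M5-a) «ELL-NORM-H»: `Θ t · conj (Θ t) = 1` for `μT`-almost every `t` of every COMPACT Cartan subgroup `T = Z_H(γ₀)` (`γ₀` `G`-regular) and ANY Haar measure `μT` on `T` —
  at a `G`-regular `t ∈ T` one has `Z_H(t) = T` (★ CARTAN-FIELDS-H `centralizer_eq_of_mem_centralizer_of_isLocalGRegular`), hence `ι_v t ∉ Ω` (★ CARTAN-ELL-H
  `isCompact_centralizer_iff_not_mem_hyperbolicSet_H`), hence `Θ t = −ξ_v(t)` (★ ELL-VALUE-H `charSt_eq_neg_xiLocalChar_of_not_mem_hyperbolicSet`) with `|ξ_v(t)| = 1`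
  (★ `norm_xiLocalChar_apply_eq_one`); and `μT`-almost every `t` is `G`-regular (★ (B4) `ae_isLocalGRegular_of_eq_centralizerH` [HarishChandra1970, Lemma 42]);
* §2 (B6) «M5 JUNCTION»: under the RUNG 0 v8 Cartan binders `hKHO`, `hHaarHO` (:143, :146) and the pins `hC02` (:150), `hM1lc` (:183), `hM1H` (:192), `eCartanH` (:196),
  `eMuTH` (:197), `eSq` (:200), read TOKEN FOR TOKEN, the ELLIPTIC WEYL MASS identity (M5-b) `∑ T ∈ SH, (weylOrder T)⁻¹ * ∫ t, (dh t)² ∂(μTHf T) = 1` (census §4.1, with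
  `hDH : ∀ s, 𝔇.DH s = dh s` abstracting the closed form `eDH` :167) implies `𝔇.PacketCharHNorm` — `Finset.sum_congr` + `integral_congr_ae` over §1.
So (M5) ⟸ (M5-b); (M5-b) is the road's remaining brick (B5) `ellipticWeylMass_H_eq_one` (Kottwitz's Euler–Poincaré function through the ★ Weyl integration formula on `H_v`).
HONEST LABEL: count-neutral helper of the «M5-H» road; (M5) stays a PRINT block consequent until (B5) is ★ and a desk-priced edition consumes `packetCharHNorm_of_ellipticWeylMass`;
HC_CM is proved only modulo the 7 printed citations (2 remaining named inputs: hLiu418 = `stmt-HodgeConjecture-24832`, h413 = `stmt-HodgeConjecture-24833`) until rung 0 closes.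

## References
* [Rogawski1990] J. D. Rogawski, *Automorphic Representations of Unitary Groups in Three Variables*, Ann. of Math. Stud. 123 (1990): §12.5 pp. 182–186 (Cor. 12.5.4 proof
  p. 186); §12.1 case (1) pp. 171–172; §3.6 pp. 28–31.
* [HarishChandra1970] Harish-Chandra (notes by G. van Dijk), *Harmonic Analysis on Reductive p-adic Groups*, LNM 162 (1970), Lemma 42.
-/

set_option autoImplicit false
-- the mandated namespace has the single-problem summit's repeated segment (`HodgeConjecture.HodgeConjecture`)
set_option linter.dupNamespace false

noncomputable section

open NumberField IsDedekindDomain MeasureTheory Filter Topology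
open scoped Matrix MatrixGroups NNReal ENNReal ComplexConjugate
open Literature.NumberTheory Literature.NumberTheory.Automorphic Literature.NumberTheory.Automorphic.UnitaryGroup
open Literature.NumberTheory.GaloisRepresentations
open Literature.NumberTheory.Rogawski1990
open Summit.HodgeConjecture.HodgeConjecture.Cruxes.H413.F0P3cStCharTSTorusDefs

namespace Summit.HodgeConjecture.HodgeConjecture.Cruxes.H413.F0P3cStCharTSEllMassHJunction

variable (L : Type) [Field L] [NumberField L] [IsCMField L] (v : HeightOneSpectrum (𝓞 ↥(maximalRealSubfield L)))

/-! ## §1 (M5-a) «ELL-NORM-H»: `|χ_{St_H(ξ)}|² = 1` at the `G`-regular points with compact centraliser, and a.e. on every compact Cartan -/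

set_option maxHeartbeats 1600000 in
set_option synthInstance.maxHeartbeats 400000 in
/-- **`Θ a · conj (Θ a) = 1` at every `G`-regular `a ∈ H_v` with COMPACT centraliser**, for any character function `Θ` of the `H`-side Steinberg label (locally constant at the
`G`-regular points, computing `Tr πSt` on test functions; labels `(π₁, πSt)` of `i_H(χ_H)` with `Tr π₁ = χ_{ξ_v}`, non-split `v`): compact `Z_H(a)` ⇒ `ι_v a ∉ Ω` (★ CARTAN-ELL-H)
⇒ `Θ a = −ξ_v(a)` (★ ELL-VALUE-H) and `|ξ_v(a)| = 1`. [cite: Rogawski1990, §12.5 pp. 183–186; §12.1 pp. 171–172] -/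
theorem charSt_mul_conj_eq_one_of_isCompact_centralizer (hns : ∀ w : PlacesOver L v, IsCMField.complexConj L • w.1 = w.1)
    [MeasurableSpace (((UnitaryGroup.cmDatum L 2 (Matrix.of fun i j : Fin 2 => if i.val + j.val + 1 = 2 then (1 : L) else 0)).Local v) × ((UnitaryGroup.cmDatum L 1 (Matrix.of fun i j : Fin 1 => if i.val + j.val + 1 = 1 then (1 : L) else 0)).Local v))] [BorelSpace (((UnitaryGroup.cmDatum L 2 (Matrix.of fun i j : Fin 2 => if i.val + j.val + 1 = 2 then (1 : L) else 0)).Local v) × ((UnitaryGroup.cmDatum L 1 (Matrix.of fun i j : Fin 1 => if i.val + j.val + 1 = 1 then (1 : L) else 0)).Local v))]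
    (νHv : Measure (((UnitaryGroup.cmDatum L 2 (Matrix.of fun i j : Fin 2 => if i.val + j.val + 1 = 2 then (1 : L) else 0)).Local v) × ((UnitaryGroup.cmDatum L 1 (Matrix.of fun i j : Fin 1 => if i.val + j.val + 1 = 1 then (1 : L) else 0)).Local v))) [νHv.IsHaarMeasure] [νHv.IsMulRightInvariant]
    (ξ : OneDimAutRepH L)
    (π₁ πSt : IrrClass (((UnitaryGroup.cmDatum L 2 (Matrix.of fun i j : Fin 2 => if i.val + j.val + 1 = 2 then (1 : L) else 0)).Local v) × ((UnitaryGroup.cmDatum L 1 (Matrix.of fun i j : Fin 1 => if i.val + j.val + 1 = 1 then (1 : L) else 0)).Local v)))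
    (hlab : HLengthTwoLabels L v
      (torusCharPair (conjLocal L (IsCMField.complexConj L) v) (cmLocalForm L 2 v) (cmLocalForm_eq_over L 2 v) 0
        ((torusLocalComponent L (IsCMField.complexConj L) v ξ.η).comp
            (quotConj (conjLocal L (IsCMField.complexConj L) v) (conjLocal_conjLocal_cm L v)) *
          halfModulusChar (UnitaryGroup.LocalRing L v))
        (torusLocalComponent L (IsCMField.complexConj L) v ξ.ψ))
      ((torusLocalComponent L (IsCMField.complexConj L) v ξ.ψ).comp (localDet (IsCMField.complexConj L) v (isUnit_antidiagOne_det L 1))) π₁ πSt)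
    (hπ₁ : ∀ fH : (((UnitaryGroup.cmDatum L 2 (Matrix.of fun i j : Fin 2 => if i.val + j.val + 1 = 2 then (1 : L) else 0)).Local v) × ((UnitaryGroup.cmDatum L 1 (Matrix.of fun i j : Fin 1 => if i.val + j.val + 1 = 1 then (1 : L) else 0)).Local v)) → ℂ, IsLocSmooth fH → π₁.smoothTrace νHv fH = charDist (ξ.xiLocalChar v) νHv fH)
    (Θ : (((UnitaryGroup.cmDatum L 2 (Matrix.of fun i j : Fin 2 => if i.val + j.val + 1 = 2 then (1 : L) else 0)).Local v) × ((UnitaryGroup.cmDatum L 1 (Matrix.of fun i j : Fin 1 => if i.val + j.val + 1 = 1 then (1 : L) else 0)).Local v)) → ℂ)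
    (hlc : ∀ x : (((UnitaryGroup.cmDatum L 2 (Matrix.of fun i j : Fin 2 => if i.val + j.val + 1 = 2 then (1 : L) else 0)).Local v) × ((UnitaryGroup.cmDatum L 1 (Matrix.of fun i j : Fin 1 => if i.val + j.val + 1 = 1 then (1 : L) else 0)).Local v)), IsLocalGRegular L v x → ∀ᶠ y in 𝓝 x, Θ y = Θ x)
    (htr : ∀ fH : (((UnitaryGroup.cmDatum L 2 (Matrix.of fun i j : Fin 2 => if i.val + j.val + 1 = 2 then (1 : L) else 0)).Local v) × ((UnitaryGroup.cmDatum L 1 (Matrix.of fun i j : Fin 1 => if i.val + j.val + 1 = 1 then (1 : L) else 0)).Local v)) → ℂ, IsLocSmooth fH → πSt.smoothTrace νHv fH = ∫ h, fH h * Θ h ∂νHv)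
    {a : (((UnitaryGroup.cmDatum L 2 (Matrix.of fun i j : Fin 2 => if i.val + j.val + 1 = 2 then (1 : L) else 0)).Local v) × ((UnitaryGroup.cmDatum L 1 (Matrix.of fun i j : Fin 1 => if i.val + j.val + 1 = 1 then (1 : L) else 0)).Local v))} (ha : IsLocalGRegular L v a)
    (hac : IsCompact ((Subgroup.centralizer ({a} : Set (((UnitaryGroup.cmDatum L 2 (Matrix.of fun i j : Fin 2 => if i.val + j.val + 1 = 2 then (1 : L) else 0)).Local v) × ((UnitaryGroup.cmDatum L 1 (Matrix.of fun i j : Fin 1 => if i.val + j.val + 1 = 1 then (1 : L) else 0)).Local v))) : Subgroup (((UnitaryGroup.cmDatum L 2 (Matrix.of fun i j : Fin 2 => if i.val + j.val + 1 = 2 then (1 : L) else 0)).Local v) × ((UnitaryGroup.cmDatum L 1 (Matrix.of fun i j : Fin 1 => if i.val + j.val + 1 = 1 then (1 : L) else 0)).Local v))) : Set (((UnitaryGroup.cmDatum L 2 (Matrix.of fun i j : Fin 2 => if i.val + j.val + 1 = 2 then (1 : L) else 0)).Local v) × ((UnitaryGroup.cmDatum L 1 (Matrix.of fun i j : Fin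 1 => if i.val + j.val + 1 = 1 then (1 : L) else 0)).Local v)))) :
    Θ a * starRingEnd ℂ (Θ a) = 1 := by
  have haΩ : endoEmbLocal L v a ∉ hyperbolicSet L v :=
    (F0P3cStCharTSEllCartanCompactH.isCompact_centralizer_iff_not_mem_hyperbolicSet_H L v hns a ha).1 hac
  rw [F0P3cStCharTSStStableEll.charSt_eq_neg_xiLocalChar_of_not_mem_hyperbolicSet L v hns νHv ξ π₁ πSt hlab hπ₁ Θ hlc htr ha haΩ,
    map_neg, neg_mul_neg, Complex.mul_conj, Complex.normSq_eq_norm_sq, OneDimAutRepH.norm_xiLocalChar_apply_eq_one ξ v a]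
  norm_num

set_option maxHeartbeats 1600000 in
set_option synthInstance.maxHeartbeats 400000 in
/-- **`Θ t · conj (Θ t) = 1` at every `G`-regular `t` of a COMPACT Cartan subgroup `T = Z_H(γ₀)`** (`γ₀` `G`-regular): `Z_H(t) = Z_H(γ₀) = T` (★ CARTAN-FIELDS-H) is compact.
[cite: Rogawski1990, §12.5 pp. 183–186; §3.6 pp. 28–31] -/
theorem charSt_mul_conj_eq_one_of_mem_compact_cartanH (hns : ∀ w : PlacesOver L v, IsCMField.complexConj L • w.1 = w.1)
    [MeasurableSpace (((UnitaryGroup.cmDatum L 2 (Matrix.of fun i j : Fin 2 => if i.val + j.val + 1 = 2 then (1 : L) else 0)).Local v) × ((UnitaryGroup.cmDatum L 1 (Matrix.of fun i j : Fin 1 => if i.val + j.val + 1 = 1 then (1 : L) else 0)).Local v))] [BorelSpace (((UnitaryGroup.cmDatum L 2 (Matrix.of fun i j : Fin 2 => if i.val + j.val + 1 = 2 then (1 : L) else 0)).Local v) × ((UnitaryGroup.cmDatum L 1 (Matrix.of fun i j : Fin 1 => if i.val + j.val + 1 = 1 then (1 : L) else 0)).Local v))]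
    (νHv : Measure (((UnitaryGroup.cmDatum L 2 (Matrix.of fun i j : Fin 2 => if i.val + j.val + 1 = 2 then (1 : L) else 0)).Local v) × ((UnitaryGroup.cmDatum L 1 (Matrix.of fun i j : Fin 1 => if i.val + j.val + 1 = 1 then (1 : L) else 0)).Local v))) [νHv.IsHaarMeasure] [νHv.IsMulRightInvariant]
    (ξ : OneDimAutRepH L)
    (π₁ πSt : IrrClass (((UnitaryGroup.cmDatum L 2 (Matrix.of fun i j : Fin 2 => if i.val + j.val + 1 = 2 then (1 : L) else 0)).Local v) × ((UnitaryGroup.cmDatum L 1 (Matrix.of fun i j : Fin 1 => if i.val + j.val + 1 = 1 then (1 : L) else 0)).Local v)))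
    (hlab : HLengthTwoLabels L v
      (torusCharPair (conjLocal L (IsCMField.complexConj L) v) (cmLocalForm L 2 v) (cmLocalForm_eq_over L 2 v) 0
        ((torusLocalComponent L (IsCMField.complexConj L) v ξ.η).comp
            (quotConj (conjLocal L (IsCMField.complexConj L) v) (conjLocal_conjLocal_cm L v)) *
          halfModulusChar (UnitaryGroup.LocalRing L v))
        (torusLocalComponent L (IsCMField.complexConj L) v ξ.ψ))
      ((torusLocalComponent L (IsCMField.complexConj L) v ξ.ψ).comp (localDet (IsCMField.complexConj L) v (isUnit_antidiagOne_det L 1))) π₁ πSt)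
    (hπ₁ : ∀ fH : (((UnitaryGroup.cmDatum L 2 (Matrix.of fun i j : Fin 2 => if i.val + j.val + 1 = 2 then (1 : L) else 0)).Local v) × ((UnitaryGroup.cmDatum L 1 (Matrix.of fun i j : Fin 1 => if i.val + j.val + 1 = 1 then (1 : L) else 0)).Local v)) → ℂ, IsLocSmooth fH → π₁.smoothTrace νHv fH = charDist (ξ.xiLocalChar v) νHv fH)
    (Θ : (((UnitaryGroup.cmDatum L 2 (Matrix.of fun i j : Fin 2 => if i.val + j.val + 1 = 2 then (1 : L) else 0)).Local v) × ((UnitaryGroup.cmDatum L 1 (Matrix.of fun i j : Fin 1 => if i.val + j.val + 1 = 1 then (1 : L) else 0)).Local v)) → ℂ)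
    (hlc : ∀ x : (((UnitaryGroup.cmDatum L 2 (Matrix.of fun i j : Fin 2 => if i.val + j.val + 1 = 2 then (1 : L) else 0)).Local v) × ((UnitaryGroup.cmDatum L 1 (Matrix.of fun i j : Fin 1 => if i.val + j.val + 1 = 1 then (1 : L) else 0)).Local v)), IsLocalGRegular L v x → ∀ᶠ y in 𝓝 x, Θ y = Θ x)
    (htr : ∀ fH : (((UnitaryGroup.cmDatum L 2 (Matrix.of fun i j : Fin 2 => if i.val + j.val + 1 = 2 then (1 : L) else 0)).Local v) × ((UnitaryGroup.cmDatum L 1 (Matrix.of fun i j : Fin 1 => if i.val + j.val + 1 = 1 then (1 : L) else 0)).Local v)) → ℂ, IsLocSmooth fH → πSt.smoothTrace νHv fH = ∫ h, fH h * Θ h ∂νHv)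
    {T : Subgroup (((UnitaryGroup.cmDatum L 2 (Matrix.of fun i j : Fin 2 => if i.val + j.val + 1 = 2 then (1 : L) else 0)).Local v) × ((UnitaryGroup.cmDatum L 1 (Matrix.of fun i j : Fin 1 => if i.val + j.val + 1 = 1 then (1 : L) else 0)).Local v))} {γ₀ : (((UnitaryGroup.cmDatum L 2 (Matrix.of fun i j : Fin 2 => if i.val + j.val + 1 = 2 then (1 : L) else 0)).Local v) × ((UnitaryGroup.cmDatum L 1 (Matrix.of fun i j : Fin 1 => if i.val + j.val + 1 = 1 then (1 : L) else 0)).Local v))} (hγ₀ : IsLocalGRegular L v γ₀)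
    (hT : T = Subgroup.centralizer ({γ₀} : Set (((UnitaryGroup.cmDatum L 2 (Matrix.of fun i j : Fin 2 => if i.val + j.val + 1 = 2 then (1 : L) else 0)).Local v) × ((UnitaryGroup.cmDatum L 1 (Matrix.of fun i j : Fin 1 => if i.val + j.val + 1 = 1 then (1 : L) else 0)).Local v)))) (hTc : IsCompact (T : Set (((UnitaryGroup.cmDatum L 2 (Matrix.of fun i j : Fin 2 => if i.val + j.val + 1 = 2 then (1 : L) else 0)).Local v) × ((UnitaryGroup.cmDatum L 1 (Matrix.of fun i j : Fin 1 => if i.val + j.val + 1 = 1 then (1 : L) else 0)).Local v))))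
    {t : (((UnitaryGroup.cmDatum L 2 (Matrix.of fun i j : Fin 2 => if i.val + j.val + 1 = 2 then (1 : L) else 0)).Local v) × ((UnitaryGroup.cmDatum L 1 (Matrix.of fun i j : Fin 1 => if i.val + j.val + 1 = 1 then (1 : L) else 0)).Local v))} (htT : t ∈ T) (ht : IsLocalGRegular L v t) :
    Θ t * starRingEnd ℂ (Θ t) = 1 := by
  subst hT
  have hZ := F0P3cStCharTSUpTrCartanFields.centralizer_eq_of_mem_centralizer_of_isLocalGRegular L v hγ₀ htT ht
  refine charSt_mul_conj_eq_one_of_isCompact_centralizer L v hns νHv ξ π₁ πSt hlab hπ₁ Θ hlc htr ht ?_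
  rw [hZ]
  exact hTc

set_option maxHeartbeats 1600000 in
set_option synthInstance.maxHeartbeats 400000 in
/-- **(M5-a) «ELL-NORM-H»: `Θ t · conj (Θ t) = 1` for `μT`-ALMOST EVERY `t` of a compact Cartan subgroup `T = Z_H(γ₀)`** (`γ₀` `G`-regular, ANY Haar measure `μT` on `T`) —
the previous lemma off the Haar-null non-`G`-regular set (★ (B4) `ae_isLocalGRegular_of_eq_centralizerH`). [cite: Rogawski1990, §12.5 pp. 183–186] [cite: HarishChandra1970, Lemma 42] -/
theorem charSt_mul_conj_eq_one_ae (hns : ∀ w : PlacesOver L v, IsCMField.complexConj L • w.1 = w.1)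
    [MeasurableSpace (((UnitaryGroup.cmDatum L 2 (Matrix.of fun i j : Fin 2 => if i.val + j.val + 1 = 2 then (1 : L) else 0)).Local v) × ((UnitaryGroup.cmDatum L 1 (Matrix.of fun i j : Fin 1 => if i.val + j.val + 1 = 1 then (1 : L) else 0)).Local v))] [BorelSpace (((UnitaryGroup.cmDatum L 2 (Matrix.of fun i j : Fin 2 => if i.val + j.val + 1 = 2 then (1 : L) else 0)).Local v) × ((UnitaryGroup.cmDatum L 1 (Matrix.of fun i j : Fin 1 => if i.val + j.val + 1 = 1 then (1 : L) else 0)).Local v))]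
    (νHv : Measure (((UnitaryGroup.cmDatum L 2 (Matrix.of fun i j : Fin 2 => if i.val + j.val + 1 = 2 then (1 : L) else 0)).Local v) × ((UnitaryGroup.cmDatum L 1 (Matrix.of fun i j : Fin 1 => if i.val + j.val + 1 = 1 then (1 : L) else 0)).Local v))) [νHv.IsHaarMeasure] [νHv.IsMulRightInvariant]
    (ξ : OneDimAutRepH L)
    (π₁ πSt : IrrClass (((UnitaryGroup.cmDatum L 2 (Matrix.of fun i j : Fin 2 => if i.val + j.val + 1 = 2 then (1 : L) else 0)).Local v) × ((UnitaryGroup.cmDatum L 1 (Matrix.of fun i j : Fin 1 => if i.val + j.val + 1 = 1 then (1 : L) else 0)).Local v)))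
    (hlab : HLengthTwoLabels L v
      (torusCharPair (conjLocal L (IsCMField.complexConj L) v) (cmLocalForm L 2 v) (cmLocalForm_eq_over L 2 v) 0
        ((torusLocalComponent L (IsCMField.complexConj L) v ξ.η).comp
            (quotConj (conjLocal L (IsCMField.complexConj L) v) (conjLocal_conjLocal_cm L v)) *
          halfModulusChar (UnitaryGroup.LocalRing L v))
        (torusLocalComponent L (IsCMField.complexConj L) v ξ.ψ))
      ((torusLocalComponent L (IsCMField.complexConj L) v ξ.ψ).comp (localDet (IsCMField.complexConj L) v (isUnit_antidiagOne_det L 1))) π₁ πSt)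
    (hπ₁ : ∀ fH : (((UnitaryGroup.cmDatum L 2 (Matrix.of fun i j : Fin 2 => if i.val + j.val + 1 = 2 then (1 : L) else 0)).Local v) × ((UnitaryGroup.cmDatum L 1 (Matrix.of fun i j : Fin 1 => if i.val + j.val + 1 = 1 then (1 : L) else 0)).Local v)) → ℂ, IsLocSmooth fH → π₁.smoothTrace νHv fH = charDist (ξ.xiLocalChar v) νHv fH)
    (Θ : (((UnitaryGroup.cmDatum L 2 (Matrix.of fun i j : Fin 2 => if i.val + j.val + 1 = 2 then (1 : L) else 0)).Local v) × ((UnitaryGroup.cmDatum L 1 (Matrix.of fun i j : Fin 1 => if i.val + j.val + 1 = 1 then (1 : L) else 0)).Local v)) → ℂ)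
    (hlc : ∀ x : (((UnitaryGroup.cmDatum L 2 (Matrix.of fun i j : Fin 2 => if i.val + j.val + 1 = 2 then (1 : L) else 0)).Local v) × ((UnitaryGroup.cmDatum L 1 (Matrix.of fun i j : Fin 1 => if i.val + j.val + 1 = 1 then (1 : L) else 0)).Local v)), IsLocalGRegular L v x → ∀ᶠ y in 𝓝 x, Θ y = Θ x)
    (htr : ∀ fH : (((UnitaryGroup.cmDatum L 2 (Matrix.of fun i j : Fin 2 => if i.val + j.val + 1 = 2 then (1 : L) else 0)).Local v) × ((UnitaryGroup.cmDatum L 1 (Matrix.of fun i j : Fin 1 => if i.val + j.val + 1 = 1 then (1 : L) else 0)).Local v)) → ℂ, IsLocSmooth fH → πSt.smoothTrace νHv fH = ∫ h, fH h * Θ h ∂νHv)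
    {T : Subgroup (((UnitaryGroup.cmDatum L 2 (Matrix.of fun i j : Fin 2 => if i.val + j.val + 1 = 2 then (1 : L) else 0)).Local v) × ((UnitaryGroup.cmDatum L 1 (Matrix.of fun i j : Fin 1 => if i.val + j.val + 1 = 1 then (1 : L) else 0)).Local v))} {γ₀ : (((UnitaryGroup.cmDatum L 2 (Matrix.of fun i j : Fin 2 => if i.val + j.val + 1 = 2 then (1 : L) else 0)).Local v) × ((UnitaryGroup.cmDatum L 1 (Matrix.of fun i j : Fin 1 => if i.val + j.val + 1 = 1 then (1 : L) else 0)).Local v))} (hγ₀ : IsLocalGRegular L v γ₀)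
    (hT : T = Subgroup.centralizer ({γ₀} : Set (((UnitaryGroup.cmDatum L 2 (Matrix.of fun i j : Fin 2 => if i.val + j.val + 1 = 2 then (1 : L) else 0)).Local v) × ((UnitaryGroup.cmDatum L 1 (Matrix.of fun i j : Fin 1 => if i.val + j.val + 1 = 1 then (1 : L) else 0)).Local v)))) (hTc : IsCompact (T : Set (((UnitaryGroup.cmDatum L 2 (Matrix.of fun i j : Fin 2 => if i.val + j.val + 1 = 2 then (1 : L) else 0)).Local v) × ((UnitaryGroup.cmDatum L 1 (Matrix.of fun i j : Fin 1 => if i.val + j.val + 1 = 1 then (1 : L) else 0)).Local v))))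
    (μT : Measure ↥T) [μT.IsHaarMeasure] :
    ∀ᵐ t : ↥T ∂μT, Θ (t : (((UnitaryGroup.cmDatum L 2 (Matrix.of fun i j : Fin 2 => if i.val + j.val + 1 = 2 then (1 : L) else 0)).Local v) × ((UnitaryGroup.cmDatum L 1 (Matrix.of fun i j : Fin 1 => if i.val + j.val + 1 = 1 then (1 : L) else 0)).Local v))) * starRingEnd ℂ (Θ (t : (((UnitaryGroup.cmDatum L 2 (Matrix.of fun i j : Fin 2 => if i.val + j.val + 1 = 2 then (1 : L) else 0)).Local v) × ((UnitaryGroup.cmDatum L 1 (Matrix.of fun i j : Fin 1 => if i.val + j.val + 1 = 1 then (1 : L) else 0)).Local v)))) = 1 :=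
  (F0P3cStCharTSEllMassHNull.ae_isLocalGRegular_of_eq_centralizerH L v hns hγ₀ hT μT).mono fun t ht =>
    charSt_mul_conj_eq_one_of_mem_compact_cartanH L v hns νHv ξ π₁ πSt hlab hπ₁ Θ hlc htr hγ₀ hT hTc t.2 ht

/-! ## §2 (B6) «M5 JUNCTION»: the block consequent (M5) `𝔇.PacketCharHNorm` AT THE PINS from the elliptic Weyl mass of `H_v` -/

set_option maxHeartbeats 1600000 in
set_option synthInstance.maxHeartbeats 400000 in
/-- **(M5) ⟸ (M5-b) AT THE PINS of RUNG 0 v8.**  Under the organ prefix (`νHv`, `ξ`, the labels `π₁ πSt` with `hlab`, `hπ₁`, non-split `v`), the Cartan binders `hKHO` (:143: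
every `T ∈ SH` is compact and `= Z_H(γ₀)` with `γ₀` `G`-regular) and `hHaarHO` (:146), and the pins `hC02 : 𝔇.μH = νHv` (:150), `hM1lc` (:183), `hM1H : 𝔇.PacketCharHRegularity`
(:192), `eCartanH : 𝔇.cartanH = SH` (:196), `eMuTH` (:197), `eSq : 𝔇.sqPacketsH = {{πSt}}` (:200) — all token for token — and `hDH : ∀ s, 𝔇.DH s = dh s` (= `eDH` :167 read
with `dh :=` its closed form): the ELLIPTIC WEYL MASS identity `∑ T ∈ SH, |Ω(T,H)|⁻¹ ∫_T dh² dμTHf(T) = 1` implies `⟨χ_ρ, χ_ρ⟩_{H,e} = Card ρ` for every `ρ ∈ 𝔇.sqPacketsH`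
(there is only `ρ = {πSt}`, and `|χ_{πSt}|² = 1` a.e. on each `T ∈ SH` by §1). [cite: Rogawski1990, §12.5 Cor. 12.5.4 proof p. 186; §12.5 p. 184; §12.7 p. 194] -/
theorem packetCharHNorm_of_ellipticWeylMass (hns : ∀ w : PlacesOver L v, IsCMField.complexConj L • w.1 = w.1)
    [MeasurableSpace (((UnitaryGroup.cmDatum L 2 (Matrix.of fun i j : Fin 2 => if i.val + j.val + 1 = 2 then (1 : L) else 0)).Local v) × ((UnitaryGroup.cmDatum L 1 (Matrix.of fun i j : Fin 1 => if i.val + j.val + 1 = 1 then (1 : L) else 0)).Local v))] [BorelSpace (((UnitaryGroup.cmDatum L 2 (Matrix.of fun i j : Fin 2 => if i.val + j.val + 1 = 2 then (1 : L) else 0)).Local v) × ((UnitaryGroup.cmDatum L 1 (Matrix.of fun i j : Fin 1 => if i.val + j.val + 1 = 1 then (1 : L) else 0)).Local v))]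
    [MeasurableSpace (Gqs L v)] [∀ γ : Gqs L v, MeasurableSpace (Gqs L v ⧸ Subgroup.centralizer ({γ} : Set (Gqs L v)))]
    [MeasurableSpace (Gqs L v ⧸ Subgroup.center (Gqs L v))]
    (νHv : Measure (((UnitaryGroup.cmDatum L 2 (Matrix.of fun i j : Fin 2 => if i.val + j.val + 1 = 2 then (1 : L) else 0)).Local v) × ((UnitaryGroup.cmDatum L 1 (Matrix.of fun i j : Fin 1 => if i.val + j.val + 1 = 1 then (1 : L) else 0)).Local v))) [νHv.IsHaarMeasure] [νHv.IsMulRightInvariant]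
    (ξ : OneDimAutRepH L)
    (π₁ πSt : IrrClass (((UnitaryGroup.cmDatum L 2 (Matrix.of fun i j : Fin 2 => if i.val + j.val + 1 = 2 then (1 : L) else 0)).Local v) × ((UnitaryGroup.cmDatum L 1 (Matrix.of fun i j : Fin 1 => if i.val + j.val + 1 = 1 then (1 : L) else 0)).Local v)))
    (hlab : HLengthTwoLabels L v
      (torusCharPair (conjLocal L (IsCMField.complexConj L) v) (cmLocalForm L 2 v) (cmLocalForm_eq_over L 2 v) 0
        ((torusLocalComponent L (IsCMField.complexConj L) v ξ.η).comp
            (quotConj (conjLocal L (IsCMField.complexConj L) v) (conjLocal_conjLocal_cm L v)) *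
          halfModulusChar (UnitaryGroup.LocalRing L v))
        (torusLocalComponent L (IsCMField.complexConj L) v ξ.ψ))
      ((torusLocalComponent L (IsCMField.complexConj L) v ξ.ψ).comp (localDet (IsCMField.complexConj L) v (isUnit_antidiagOne_det L 1))) π₁ πSt)
    (hπ₁ : ∀ fH : (((UnitaryGroup.cmDatum L 2 (Matrix.of fun i j : Fin 2 => if i.val + j.val + 1 = 2 then (1 : L) else 0)).Local v) × ((UnitaryGroup.cmDatum L 1 (Matrix.of fun i j : Fin 1 => if i.val + j.val + 1 = 1 then (1 : L) else 0)).Local v)) → ℂ, IsLocSmooth fH → π₁.smoothTrace νHv fH = charDist (ξ.xiLocalChar v) νHv fH)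
    (SH : Finset (Subgroup (((UnitaryGroup.cmDatum L 2 (Matrix.of fun i j : Fin 2 => if i.val + j.val + 1 = 2 then (1 : L) else 0)).Local v) × ((UnitaryGroup.cmDatum L 1 (Matrix.of fun i j : Fin 1 => if i.val + j.val + 1 = 1 then (1 : L) else 0)).Local v)))) (μTHf : (T' : Subgroup (((UnitaryGroup.cmDatum L 2 (Matrix.of fun i j : Fin 2 => if i.val + j.val + 1 = 2 then (1 : L) else 0)).Local v) × ((UnitaryGroup.cmDatum L 1 (Matrix.of fun i j : Fin 1 => if i.val + j.val + 1 = 1 then (1 : L) else 0)).Local v))) → Measure ↥T')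
    (hKHO : ∀ T' ∈ SH, IsCompact (T' : Set (((UnitaryGroup.cmDatum L 2 (Matrix.of fun i j : Fin 2 => if i.val + j.val + 1 = 2 then (1 : L) else 0)).Local v) × ((UnitaryGroup.cmDatum L 1 (Matrix.of fun i j : Fin 1 => if i.val + j.val + 1 = 1 then (1 : L) else 0)).Local v))) ∧ ∃ γ₀ : (((UnitaryGroup.cmDatum L 2 (Matrix.of fun i j : Fin 2 => if i.val + j.val + 1 = 2 then (1 : L) else 0)).Local v) × ((UnitaryGroup.cmDatum L 1 (Matrix.of fun i j : Fin 1 => if i.val + j.val + 1 = 1 then (1 : L) else 0)).Local v)), IsLocalGRegular L v γ₀ ∧ T' = Subgroup.centralizer ({γ₀} : Set (((UnitaryGroup.cmDatum L 2 (Matrix.of fun i j : Fin 2 => if i.val + j.val + 1 = 2 then (1 : L) else 0)).Local v) × ((UnitaryGroup.cmDatum L 1 (Matrix.of fun i j : Fin 1 => if i.val + j.val + 1 = 1 then (1 : L) else 0)).Local v))))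
    (hHaarHO : ∀ T' ∈ SH, (μTHf T').IsHaarMeasure)
    (𝔇 : Ch12Sec5.EllipticData (Gqs L v) (((UnitaryGroup.cmDatum L 2 (Matrix.of fun i j : Fin 2 => if i.val + j.val + 1 = 2 then (1 : L) else 0)).Local v) × ((UnitaryGroup.cmDatum L 1 (Matrix.of fun i j : Fin 1 => if i.val + j.val + 1 = 1 then (1 : L) else 0)).Local v)))
    (hC02 : 𝔇.μH = νHv)
    (dh : (((UnitaryGroup.cmDatum L 2 (Matrix.of fun i j : Fin 2 => if i.val + j.val + 1 = 2 then (1 : L) else 0)).Local v) × ((UnitaryGroup.cmDatum L 1 (Matrix.of fun i j : Fin 1 => if i.val + j.val + 1 = 1 then (1 : L) else 0)).Local v)) → ℝ) (hDH : ∀ s : (((UnitaryGroup.cmDatum L 2 (Matrix.of fun i j : Fin 2 => if i.val + j.val + 1 = 2 then (1 : L) else 0)).Local v) × ((UnitaryGroup.cmDatum L 1 (Matrix.of fun i j : Fin 1 => if i.val + j.val + 1 = 1 then (1 : L) else 0)).Local v)), 𝔇.DH s = dh s)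
    (hM1lc : ∀ ρ ∈ 𝔇.sqPacketsH, ∀ a : (((UnitaryGroup.cmDatum L 2 (Matrix.of fun i j : Fin 2 => if i.val + j.val + 1 = 2 then (1 : L) else 0)).Local v) × ((UnitaryGroup.cmDatum L 1 (Matrix.of fun i j : Fin 1 => if i.val + j.val + 1 = 1 then (1 : L) else 0)).Local v)), IsLocalGRegular L v a → ∀ᶠ a' in 𝓝 a, 𝔇.packetCharH ρ a' = 𝔇.packetCharH ρ a)
    (hM1H : 𝔇.PacketCharHRegularity)
    (eCartanH : 𝔇.cartanH = SH)
    (eMuTH : ∀ T' : Subgroup (((UnitaryGroup.cmDatum L 2 (Matrix.of fun i j : Fin 2 => if i.val + j.val + 1 = 2 then (1 : L) else 0)).Local v) × ((UnitaryGroup.cmDatum L 1 (Matrix.of fun i j : Fin 1 => if i.val + j.val + 1 = 1 then (1 : L) else 0)).Local v)), 𝔇.μTH T' = μTHf T')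
    (eSq : 𝔇.sqPacketsH = {({πSt} : Finset (IrrClass (((UnitaryGroup.cmDatum L 2 (Matrix.of fun i j : Fin 2 => if i.val + j.val + 1 = 2 then (1 : L) else 0)).Local v) × ((UnitaryGroup.cmDatum L 1 (Matrix.of fun i j : Fin 1 => if i.val + j.val + 1 = 1 then (1 : L) else 0)).Local v))))})
    (hmass : ∑ T ∈ SH, ((Ch12Sec5.weylOrder T : ℂ))⁻¹ * ∫ t : ↥T, ((dh (t : (((UnitaryGroup.cmDatum L 2 (Matrix.of fun i j : Fin 2 => if i.val + j.val + 1 = 2 then (1 : L) else 0)).Local v) × ((UnitaryGroup.cmDatum L 1 (Matrix.of fun i j : Fin 1 => if i.val + j.val + 1 = 1 then (1 : L) else 0)).Local v))) : ℂ) ^ 2) ∂(μTHf T) = 1) :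
    𝔇.PacketCharHNorm := by
  intro ρ hρ
  have hρ' : ρ = {πSt} := by simpa [eSq] using hρ
  subst hρ'
  have hmem : ({πSt} : Finset (IrrClass (((UnitaryGroup.cmDatum L 2 (Matrix.of fun i j : Fin 2 => if i.val + j.val + 1 = 2 then (1 : L) else 0)).Local v) × ((UnitaryGroup.cmDatum L 1 (Matrix.of fun i j : Fin 1 => if i.val + j.val + 1 = 1 then (1 : L) else 0)).Local v)))) ∈ 𝔇.sqPacketsH := hρ
  -- the two character pins of `Θ := χ_{πSt} = 𝔇.packetCharH {πSt}`
  have hlc : ∀ x : (((UnitaryGroup.cmDatum L 2 (Matrix.of fun i j : Fin 2 => if i.val + j.val + 1 = 2 then (1 : L) else 0)).Local v) × ((UnitaryGroup.cmDatum L 1 (Matrix.of fun i j : Fin 1 => if i.val + j.val + 1 = 1 then (1 : L) else 0)).Local v)), IsLocalGRegular L v x → ∀ᶠ y in 𝓝 x, 𝔇.packetCharH {πSt} y = 𝔇.packetCharH {πSt} x :=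
    fun x hx => hM1lc {πSt} hmem x hx
  have htr : ∀ fH : (((UnitaryGroup.cmDatum L 2 (Matrix.of fun i j : Fin 2 => if i.val + j.val + 1 = 2 then (1 : L) else 0)).Local v) × ((UnitaryGroup.cmDatum L 1 (Matrix.of fun i j : Fin 1 => if i.val + j.val + 1 = 1 then (1 : L) else 0)).Local v)) → ℂ, IsLocSmooth fH → πSt.smoothTrace νHv fH = ∫ h, fH h * 𝔇.packetCharH {πSt} h ∂νHv := by
    intro fH hfH
    have h5 := (hM1H {πSt} hmem).2.2.2.2 fH hfH
    rw [Finset.sum_singleton, hC02] at h5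
    exact h5
  rw [Finset.card_singleton, Nat.cast_one, ← hmass, Ch12Sec5.EllipticData.innerH, eCartanH]
  refine Finset.sum_congr rfl fun T hT => ?_
  obtain ⟨hTc, γ₀, hγ₀, hTeq⟩ := hKHO T hT
  haveI : (μTHf T).IsHaarMeasure := hHaarHO T hT
  rw [eMuTH T]
  congr 1
  refine integral_congr_ae ?_
  filter_upwards [charSt_mul_conj_eq_one_ae L v hns νHv ξ π₁ πSt hlab hπ₁ (𝔇.packetCharH {πSt}) hlc htr hγ₀ hTeq hTc (μTHf T)] with t ht
  rw [hDH, mul_assoc, ht, mul_one]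

end Summit.HodgeConjecture.HodgeConjecture.Cruxes.H413.F0P3cStCharTSEllMassHJunction

end
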